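import Summits.QuantumFields.BalabanUV.Beta.CompositeMixedWardGraded
import Summits.QuantumFields.BalabanUV.Beta.CompositeTablesParity
import Summits.QuantumFields.BalabanUV.Beta.AveragingWardRootedStencils

/-!
# `BalabanUV.Beta.CompositeMixedWardLetter` — row D1 ∕ (C1), PART 110g: THE (W)_j MIXED LETTER's PARITY AT THE TABLE LEVEL — the remainder forced by the letter
# `hM₂` over the GRADED composite mixed table is ROW-PARITY-ODD under the lock `cH·c₂ = ξ·cM` (generic bricks, every depth)

HONEST DEPENDENCY (page 1, mandatory): continuum YM on T⁴ ⇐ BetaPertH ∧ nine spine estimates (0/9 proved); BetaPertH ⇐ (D1) ∧ (D4) ∧ CAP+tail;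
G-an2-4 gates asym, D1 and NE2/3/4.  HONEST FRAMING (cell contract, verbatim): «discharging `BetaPertH` makes Bałaban's UV stability UNCONDITIONAL —
a real constructive-QFT result; it is NOT the continuum limit and NOT the Clay problem.»  ABSOLUTE RULE (cell charter, verbatim): «No internally-minted
statement may enter as a cited fact. Every hypothesis is either kernel-proved in this package or a verbatim quotation of a PUBLISHED theorem with page
reference. The manuscript(s) under audit are NOT citable for their own disputed steps — they are the thing under adjudication; programme-internal
(2001/route/tribunal) claims are never citable.»

WHY (row-D1 owner an2 gen 86; FINDING AN2-86-2, journal [AN2-G86-S-11∕S-12]).  an2 g29's member-0 machinery (`WardLocusRecursiveAllSlot.divW_WrecOf_zero_of_letters`)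
takes the MIXED letter `hM₂`: `cH • Σ_{v ∈ box} divV (κ u ↦ M2 κ u ρ′ w) (N•Y + v) = comp (M ρ′ w) (diagK (ξ • Σ_v legInd ρ (N•Y + v))) − comp (diagK …) (M ρ′ w) + RM Y ρ′ w`
with ANY remainder `RM`, and the residual glue needs `RM` ROW-PARITY-ODD (`trK = −sgnK`; at j = 0 an2 g21 `MixedWardSiteLaw.mixedWardBinders` ∕ `SymMixedWardPacking`).
PART 110e proved, for the GRADED composite mixed KERNEL `compMixKerG` over any bricks under the window laws, the `f ↔ f′`-symmetrised background law in the
ordinary finest-leg form.  THIS FILE packs it: with the mixed TABLE `M2 := c₂ • compMixFFG ℓ 𝓋 𝒽 𝓉 L m` (F6c's packer, graded kernel) and the multiplier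
table `M := cM • compHessFF ℓ 𝒽 L m`, the remainder DEFINED by the letter (left side minus the commutator datum — written out, no `def`) is row-parity-odd
under the lock `cH·c₂ = ξ·cM`, for every coarse site `Y`, coarse bond `(ρ′, w)`, root `ρ` of the generator and every depth `m`:
**`parityOdd_mixedLetterRemainder`**.  Field–field block: PART 110e summed over the block + antisymmetry of the composite Hessian (`compVHKer_swap`) + the lock
(one `linear_combination`); every block touching a multiplier leg vanishes on both sides (`packFF`, `compHessFF_inl_inr ∕ _inr`).

WHAT: [folklore] kernel-entry bookkeeping BY NAME; no `def`, no `def … : Prop`, nothing cited, 0 sorry.  Nothing of Bałaban's asserted, valued or discharged; 0 estimates;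
0∕4 row-D1 binders; (W)_j NOT claimed (the letter's parity half at table level; the remainder's BOUND, the Λ-weights `M2Of ∕ M1Of` at member 0 and the record-level
instantiation remain); NOT (C1), NOT D1, NEVER «G-an2-4 closed», NOT BetaPertH, NOT continuum, NOT Clay.  Row D1 ∕ (C1) OWNER «beta-an2», gen 86, 2026-08-30.
No existing file touched.
-/

noncomputable section

open Finset
open scoped BigOperators
open Literature.MathematicalPhysics.QuantumFieldTheory.Balaban1983to89
open Literature.MathematicalPhysics.QuantumFieldTheory.Balaban1983to89.Beta
open ExpKernelCalculus (MKer comp)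
open OneStepResolventKernel (Fib)
open KernelWard (divV)
open AffineAveraging (Site box toSite unitVec)
open AveragingHessianKernels (Bond Near)
open AveragingWardStencils (b6UnitVec_eq)
open Summit.QuantumFields.BalabanUV.Beta.TameKernelCalculus (trK trK_apply)
open Summit.QuantumFields.BalabanUV.Beta.BorderedHessian (diagK sgnK sgnK_apply sgnF sgnF_inl sgnF_inr comp_diagK_right comp_diagK_left)
open Summit.QuantumFields.BalabanUV.Beta.AveragingWardRootedStencils (legInd legInd_inl legInd_inr)
open Summit.QuantumFields.BalabanUV.Beta.CompositeVertexKernelRec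
open Summit.QuantumFields.BalabanUV.Beta.CompositeHessianTable (packFF packFF_inl_inl packFF_inl_inr packFF_inr compHessFF compHessFF_inl_inl compVHKer_swap)
open Summit.QuantumFields.BalabanUV.Beta.CompositeTablesParity (compHessFF_inl_inr compHessFF_inr)
open Summit.QuantumFields.BalabanUV.Beta.CompositeMixedTableGraded (compMixKerG compMixFFG compMixFFG_inl_inl)
open Summit.QuantumFields.BalabanUV.Beta.CompositeMixedWardGraded (compMixKerG_div_bg_symm)

namespace Summit.QuantumFields.BalabanUV.Beta.CompositeMixedWardLetter

variable {d : ℕ}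

section Generic

variable {ℓ : ℕ → Fin (d + 1) → Site (d + 1) → Bond (d + 1) → ℝ}
  {𝓋 𝒽 : ℕ → Fin (d + 1) → Site (d + 1) → Bond (d + 1) → Bond (d + 1) → ℝ}
  {𝓉 : ℕ → Fin (d + 1) → Site (d + 1) → Bond (d + 1) → Bond (d + 1) → Bond (d + 1) → ℝ} {L : ℕ}
  {ρ : ℕ → Site (d + 1)} {R : ℕ → Site (d + 1)}
  (hR0 : R 0 = 0) (hRs : ∀ m : ℕ, R (m + 1) = R m + ((L ^ m : ℕ) : ℤ) • ρ m)
  (hℓW : ∀ (k : ℕ) (μ : Fin (d + 1)) (y : Site (d + 1)) (G : Site (d + 1) → ℝ),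
    ∑ κ : Fin (d + 1), ∑ e ∈ offs L, ℓ k μ y (κ, (L : ℤ) • y + e) * (G ((L : ℤ) • y + e + unitVec κ) - G ((L : ℤ) • y + e)) =
      G ((L : ℤ) • y + ρ k + (L : ℤ) • unitVec μ) - G ((L : ℤ) • y + ρ k))
  (h𝓋W : ∀ (k : ℕ) (μ : Fin (d + 1)) (y : Site (d + 1)) (f : Bond (d + 1)) (G : Site (d + 1) → ℝ),
    ∑ κ : Fin (d + 1), ∑ e ∈ offs L, 𝓋 k μ y f (κ, (L : ℤ) • y + e) * (G ((L : ℤ) • y + e + unitVec κ) - G ((L : ℤ) • y + e)) =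
      (G ((L : ℤ) • y + ρ k) - G f.2) * ℓ k μ y f)
  (h𝓉W : ∀ (k : ℕ) (μ : Fin (d + 1)) (y : Site (d + 1)) (f f' : Bond (d + 1)) (G : Site (d + 1) → ℝ),
    ∑ κ : Fin (d + 1), ∑ e ∈ offs L, 𝓉 k μ y (κ, (L : ℤ) • y + e) f f' * (G ((L : ℤ) • y + e + unitVec κ) - G ((L : ℤ) • y + e)) =
      2 * 𝒽 k μ y f f' * (G ((L : ℤ) • y + ρ k) - G f.2))
  (h𝒽a : ∀ (k : ℕ) (μ : Fin (d + 1)) (y : Site (d + 1)) (f f' : Bond (d + 1)), 𝒽 k μ y f' f = -𝒽 k μ y f f')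

include hR0 hRs hℓW h𝓋W h𝓉W h𝒽a in
/-- [folklore] **THE BLOCK-SUMMED SYMMETRISED MIXED LAW AT TWO FLUCTUATION LEGS** (PART 110e summed over the block `box (d+1) N` of the coarse site `Y`, any `N`):
`Σ_{v} Σ_κ [(Kᴳ(κ, N•Y+v−e_κ; f,f′) − Kᴳ(κ, N•Y+v; f,f′)) + (f ↔ f′)] = 2·Ĥ(f,f′)·(Σ_v [f′.2 = N•Y+v] − Σ_v [f.2 = N•Y+v])`. -/
theorem blockSum_compMixKerG_div_bg_symm (N m : ℕ) (Y : Site (d + 1)) (μ : Fin (d + 1)) (y : Site (d + 1)) (f f' : Bond (d + 1)) :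
    ∑ v ∈ box (d + 1) N, ∑ κ₀ : Fin (d + 1),
        ((compMixKerG ℓ 𝓋 𝒽 𝓉 L m μ y (κ₀, ((N : ℤ) • Y + toSite v) - unitVec κ₀) f f' - compMixKerG ℓ 𝓋 𝒽 𝓉 L m μ y (κ₀, (N : ℤ) • Y + toSite v) f f') +
          (compMixKerG ℓ 𝓋 𝒽 𝓉 L m μ y (κ₀, ((N : ℤ) • Y + toSite v) - unitVec κ₀) f' f - compMixKerG ℓ 𝓋 𝒽 𝓉 L m μ y (κ₀, (N : ℤ) • Y + toSite v) f' f)) =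
      2 * compVHKer ℓ 𝒽 L m μ y f f' *
        ((∑ v ∈ box (d + 1) N, (if f'.2 = (N : ℤ) • Y + toSite v then (1 : ℝ) else 0)) -
          ∑ v ∈ box (d + 1) N, (if f.2 = (N : ℤ) • Y + toSite v then (1 : ℝ) else 0)) := by
  rw [← Finset.sum_sub_distrib, Finset.mul_sum]
  exact Finset.sum_congr rfl fun v _ => compMixKerG_div_bg_symm hR0 hRs hℓW h𝓋W h𝓉W h𝒽a ((N : ℤ) • Y + toSite v) m μ y f f'

include hR0 hRs hℓW h𝓋W h𝓉W h𝒽a in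
/-- [folklore] **THE REMAINDER FORCED BY THE MIXED LETTER OVER THE GRADED COMPOSITE MIXED TABLE IS ROW-PARITY-ODD** (generic bricks under the window laws, antisymmetric
Hessian brick; tables `M2 := c₂ • compMixFFG … m`, `M := cM • compHessFF … m`; any lattice `N`, coarse site `Y`, coarse bond `(ρ′, w)`, generator root `ρ₀`, weight `ξ`; LOCK
`cH·c₂ = ξ·cM`): `trK RM = −sgnK RM` for
`RM := cH • Σ_{v ∈ box N} divV (κ u ↦ c₂ • compMixFFG … m κ u ρ′ w) (N•Y + v) − (comp M (diagK (ξ • Σ_v legInd ρ₀ (N•Y+v))) − comp (diagK …) M)`. -/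
theorem parityOdd_mixedLetterRemainder (N m : ℕ) (Y ρ₀ : Site (d + 1)) (ρ' : Fin (d + 1)) (w : Site (d + 1)) {cH c₂ cM ξ : ℝ}
    (hlock : cH * c₂ = ξ * cM) :
    trK (cH • ∑ v ∈ box (d + 1) N, divV (fun κ u => c₂ • compMixFFG ℓ 𝓋 𝒽 𝓉 L m κ u ρ' w) ((N : ℤ) • Y + toSite v) -
        (comp (cM • compHessFF ℓ 𝒽 L m ρ' w) (diagK (ξ • ∑ v ∈ box (d + 1) N, legInd ρ₀ ((N : ℤ) • Y + toSite v))) -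
          comp (diagK (ξ • ∑ v ∈ box (d + 1) N, legInd ρ₀ ((N : ℤ) • Y + toSite v))) (cM • compHessFF ℓ 𝒽 L m ρ' w))) =
      -sgnK (cH • ∑ v ∈ box (d + 1) N, divV (fun κ u => c₂ • compMixFFG ℓ 𝓋 𝒽 𝓉 L m κ u ρ' w) ((N : ℤ) • Y + toSite v) -
        (comp (cM • compHessFF ℓ 𝒽 L m ρ' w) (diagK (ξ • ∑ v ∈ box (d + 1) N, legInd ρ₀ ((N : ℤ) • Y + toSite v))) -
          comp (diagK (ξ • ∑ v ∈ box (d + 1) N, legInd ρ₀ ((N : ℤ) • Y + toSite v))) (cM • compHessFF ℓ 𝒽 L m ρ' w))) := by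
  funext x x' a b
  simp only [trK_apply, Pi.neg_apply, sgnK_apply]
  rcases a with β | ν <;> rcases b with β' | ν'
  · -- field–field: PART 110e summed over the block, antisymmetry of the composite Hessian, and the lock
    have hS := blockSum_compMixKerG_div_bg_symm hR0 hRs hℓW h𝓋W h𝓉W h𝒽a N m Y ρ' w (β, x) (β', x')
    have hHa := compVHKer_swap (ℓ := ℓ) (L := L) h𝒽a m ρ' w (β, x) (β', x')
    simp only [sgnF_inl, one_mul, Pi.sub_apply, Pi.smul_apply, Finset.sum_apply, smul_eq_mul, KernelWard.divV, b6UnitVec_eq,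
      compMixFFG_inl_inl, comp_diagK_right, comp_diagK_left, compHessFF_inl_inl, legInd_inl, hHa]
    simp only [← mul_sub, ← Finset.mul_sum]
    simp only [Finset.sum_add_distrib] at hS
    linear_combination (cH * c₂) * hS +
      (2 * compVHKer ℓ 𝒽 L m ρ' w (β, x) (β', x') *
        ((∑ v ∈ box (d + 1) N, (if x' = (N : ℤ) • Y + toSite v then (1 : ℝ) else 0)) -
          ∑ v ∈ box (d + 1) N, (if x = (N : ℤ) • Y + toSite v then (1 : ℝ) else 0))) * hlock
  · simp [Pi.sub_apply, Pi.smul_apply, Finset.sum_apply, KernelWard.divV, compMixFFG, packFF_inr, comp_diagK_right, comp_diagK_left, compHessFF_inr]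
  · simp [Pi.sub_apply, Pi.smul_apply, Finset.sum_apply, KernelWard.divV, compMixFFG, packFF_inr, comp_diagK_right, comp_diagK_left, compHessFF_inr]
  · simp [Pi.sub_apply, Pi.smul_apply, Finset.sum_apply, KernelWard.divV, compMixFFG, packFF_inr, comp_diagK_right, comp_diagK_left, compHessFF_inr]

end Generic

end Summit.QuantumFields.BalabanUV.Beta.CompositeMixedWardLetter

end
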